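import Literature.NumberTheory.GaloisRepresentations.LubinTateColemanUnitsLogDeriv
import HarnessLib

/-!
# The invariant derivation `D = ω_F · d/dX` and the Coates–Wiles homomorphisms (log-free)

De Shalit, *Iwasawa theory of elliptic curves with complex multiplication* (1987), Ch. I §3.5: with the
translation invariant derivation `D = (1/λ') d/dX` of `F_f`, the `k`-th **Coates–Wiles homomorphism** is
`φ_k(β) = ∫_G κ(σ)^k dμ_β(σ) = D^k log g_β (0)` (formula (11)), and it satisfies
(i) `φ_k(ββ') = φ_k(β) + φ_k(β')`, (ii) `φ_k(γβ) = κ(γ)^k φ_k(β)`.  Since `D log g = δg` (Coleman's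
logarithmic derivative, `LubinTateColemanLogDeriv.lean`), `D^k log g = D^{k-1} δg` for `k ≥ 1`: this file
defines, LOG-FREE and for `f = πX + X^q` over `𝒪[F]` (`F` any non-archimedean local field, no parity
hypothesis),

* `invDeriv hπ` — the invariant derivation `D h = ω_F · h'` as an `𝒪[F]`-linear map, with
  ★ `invDeriv_subst_hom` / `invDeriv_pow_subst_hom`: **`D^k (h ∘ [a]_f) = a^k · (D^k h) ∘ [a]_f`**
  (the `[a]`-equivariance of `ω_F`, `LubinTateInvariantDifferential.lean`);
* `coatesWiles hπ k g = (D^k δg)(0)` (`= φ_{k+1}(g)`) for units `g ∈ 𝒪[F]⟦X⟧ˣ`, with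
  ★ `coatesWiles_mul` ((i)) and ★ `coatesWiles_eq_of_eq_subst_hom`: `φ(g ∘ [a]) = a^{k+1} φ(g)` ((ii));
* on Coleman's norm-coherent units `𝒰`: `NormCoherentUnits.coatesWiles k β = (D^k δ g_β)(0)` with
  ★ `coatesWiles_mul`, ★ `coatesWiles_unitAct` / `coatesWiles_galAct`:
  **`φ_{k+1}(σβ) = χ_π(σ)^{k+1} · φ_{k+1}(β)`** for `σ ∈ Γ_F` — de Shalit I §3.5 (i), (ii).

Everything here is proved (0 sorry).

## References

* E. de Shalit, *Iwasawa theory of elliptic curves with complex multiplication* (1987), Ch. I §3.5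
  (11), (i), (ii). [deShalit1987]
* J. Coates, A. Wiles, *On the conjecture of Birch and Swinnerton-Dyer*, Invent. Math. 39 (1977). [CoatesWiles1977]
-/

noncomputable section

open scoped PowerSeries.WithPiTopology

namespace Literature.NumberTheory.GaloisRepresentations

section LocalFieldCW

open GaloisRepresentations.IsNonarchimedeanLocalField LubinTate ValuativeRel

variable (F : Type*) [Field F] [ValuativeRel F] [TopologicalSpace F] [IsNonarchimedeanLocalField F]

attribute [local instance] ltNormUniformSpace ltNormIsUniformAddGroup rk1 nF nE fintypeResidueField

variable {F}
variable {π : 𝒪[F]} (hπ : (valuation F).IsUniformizer (π : F))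

/-! ### The invariant derivation -/

/-- **The invariant derivation `D h = ω_F · h'`** of `F_f` on `𝒪[F]⟦X⟧` (de Shalit's `D = (1/λ') d/dX`,
`ω_F = invDiff = 1/λ'`), as an `𝒪[F]`-linear map. [cite: deShalit1987, Ch. I §3.5] -/
def invDeriv : PowerSeries (LTCoeff F) →ₗ[LTCoeff F] PowerSeries (LTCoeff F) where
  toFun h := invDiff (isLTRing_LTCoeff hπ) (isLTSeries_LTCoeff π) * PowerSeries.derivative (LTCoeff F) h
  map_add' h h' := by rw [map_add, mul_add]
  map_smul' a h := by rw [(PowerSeries.derivative (LTCoeff F)).map_smul, RingHom.id_apply, mul_smul_comm]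

/-- Unfolding `invDeriv`. [cite: deShalit1987, Ch. I §3.5] -/
theorem invDeriv_apply (h : PowerSeries (LTCoeff F)) :
    invDeriv hπ h = invDiff (isLTRing_LTCoeff hπ) (isLTSeries_LTCoeff π) * PowerSeries.derivative (LTCoeff F) h :=
  rfl

/-- `D (C c · h) = C c · D h`. [cite: deShalit1987, Ch. I §3.5] -/
theorem invDeriv_C_mul (c : LTCoeff F) (h : PowerSeries (LTCoeff F)) :
    invDeriv hπ (PowerSeries.C c * h) = PowerSeries.C c * invDeriv hπ h := by
  rw [← PowerSeries.smul_eq_C_mul, ← PowerSeries.smul_eq_C_mul, map_smul]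

/-- `D^k (C c · h) = C c · D^k h`. [cite: deShalit1987, Ch. I §3.5] -/
theorem invDeriv_pow_C_mul (k : ℕ) (c : LTCoeff F) (h : PowerSeries (LTCoeff F)) :
    (invDeriv hπ ^ k) (PowerSeries.C c * h) = PowerSeries.C c * (invDeriv hπ ^ k) h := by
  rw [← PowerSeries.smul_eq_C_mul, ← PowerSeries.smul_eq_C_mul, map_smul]

/-- `δg = D`-flavour: Coleman's logarithmic derivative is `ω_F · g'/g` (restated for reference).
[cite: deShalit1987, Ch. I §3.12] -/
theorem logDeriv_eq_invDeriv_mul (g : (PowerSeries (LTCoeff F))ˣ) :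
    logDeriv hπ g = invDeriv hπ (g : PowerSeries (LTCoeff F)) * ↑g⁻¹ := by
  rw [logDeriv_def, invDeriv_apply, PowerSeries.dlog_def, mul_assoc]

/-- ★ **`[a]`-equivariance of the invariant derivation**: `D (h ∘ [a]_f) = a · (D h) ∘ [a]_f`.
[cite: deShalit1987, Ch. I §3.5] -/
theorem invDeriv_subst_hom (a : 𝒪[F]) (h : PowerSeries (LTCoeff F)) :
    invDeriv hπ (h.subst (hom (isLTRing_LTCoeff hπ) (isLTSeries_LTCoeff π) (isLTSeries_LTCoeff π)
        (LTCoeff.of F a))) =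
      PowerSeries.C (LTCoeff.of F a) * (invDeriv hπ h).subst
        (hom (isLTRing_LTCoeff hπ) (isLTSeries_LTCoeff π) (isLTSeries_LTCoeff π) (LTCoeff.of F a)) := by
  set hA := isLTRing_LTCoeff (F := F) hπ
  set hf := isLTSeries_LTCoeff (F := F) π
  set g := hom hA hf hf (LTCoeff.of F a) with hg
  have hs : PowerSeries.HasSubst g := PowerSeries.HasSubst.of_constantCoeff_zero' (constantCoeff_hom hA hf hf _)
  have key := invDiff_mul_derivative_hom (S := unitBall (ltField π 0)) hA hf
    (algebraMap_LTCoeff_injective (ltField π 0)) (LTCoeff.of F a)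
  rw [invDeriv_apply, invDeriv_apply, PowerSeries.derivative_subst (LTCoeff F) hs, PowerSeries.subst_mul hs]
  calc invDiff hA hf * ((PowerSeries.derivative (LTCoeff F) h).subst g * PowerSeries.derivative (LTCoeff F) g)
      = (invDiff hA hf * PowerSeries.derivative (LTCoeff F) g) * (PowerSeries.derivative (LTCoeff F) h).subst g := by
        ring
    _ = PowerSeries.C (LTCoeff.of F a) * (invDiff hA hf).subst g * (PowerSeries.derivative (LTCoeff F) h).subst g := by
        rw [hg, key]
    _ = _ := by ring

/-- ★ **`D^k (h ∘ [a]_f) = a^k · (D^k h) ∘ [a]_f`.** [cite: deShalit1987, Ch. I §3.5] -/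
theorem invDeriv_pow_subst_hom (a : 𝒪[F]) (k : ℕ) (h : PowerSeries (LTCoeff F)) :
    (invDeriv hπ ^ k) (h.subst (hom (isLTRing_LTCoeff hπ) (isLTSeries_LTCoeff π) (isLTSeries_LTCoeff π)
        (LTCoeff.of F a))) =
      PowerSeries.C (LTCoeff.of F a ^ k) * ((invDeriv hπ ^ k) h).subst
        (hom (isLTRing_LTCoeff hπ) (isLTSeries_LTCoeff π) (isLTSeries_LTCoeff π) (LTCoeff.of F a)) := by
  induction k with
  | zero => rw [pow_zero, pow_zero, map_one, one_mul, Module.End.one_apply, Module.End.one_apply]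
  | succ k ih =>
    rw [pow_succ', Module.End.mul_apply, ih, invDeriv_C_mul, invDeriv_subst_hom, Module.End.mul_apply,
      ← mul_assoc, ← map_mul, pow_succ]

/-! ### The Coates–Wiles homomorphisms -/

omit [TopologicalSpace F] [IsNonarchimedeanLocalField F] in
/-- The constant term of `H ∘ g` is that of `H` when `g(0) = 0`. [cite: deShalit1987, Ch. I §3.5] -/
theorem constantCoeff_subst_of_constantCoeff_eq_zero {g : PowerSeries (LTCoeff F)}
    (hg : PowerSeries.constantCoeff g = 0) (H : PowerSeries (LTCoeff F)) :
    PowerSeries.constantCoeff (H.subst g) = PowerSeries.constantCoeff H := by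
  have hs : PowerSeries.HasSubst g := PowerSeries.HasSubst.of_constantCoeff_zero' hg
  rw [← PowerSeries.coeff_zero_eq_constantCoeff_apply, PowerSeries.coeff_subst' hs, finsum_eq_single _ 0]
  · rw [pow_zero, smul_eq_mul, PowerSeries.coeff_zero_one, mul_one, PowerSeries.coeff_zero_eq_constantCoeff_apply]
  · intro d hd
    rw [PowerSeries.coeff_zero_eq_constantCoeff_apply, map_pow, hg, zero_pow hd, smul_zero]

/-- **The (log-free) Coates–Wiles homomorphisms** `coatesWiles k g = (D^k δg)(0) ∈ 𝒪[F]` of a unit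
`g ∈ 𝒪[F]⟦X⟧ˣ` — de Shalit's `φ_{k+1}(β) = D^{k+1} log g_β (0) = (D^k δg_β)(0)` (formula (11); here for
any unit series). [cite: deShalit1987, Ch. I §3.5 (11)] -/
def coatesWiles (k : ℕ) (g : (PowerSeries (LTCoeff F))ˣ) : LTCoeff F :=
  PowerSeries.constantCoeff ((invDeriv hπ ^ k) (logDeriv hπ g))

/-- Unfolding. [cite: deShalit1987, Ch. I §3.5 (11)] -/
theorem coatesWiles_def (k : ℕ) (g : (PowerSeries (LTCoeff F))ˣ) :
    coatesWiles hπ k g = PowerSeries.constantCoeff ((invDeriv hπ ^ k) (logDeriv hπ g)) := rfl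

/-- ★ **(i) `φ(gg') = φ(g) + φ(g')`.** [cite: deShalit1987, Ch. I §3.5 (i)] -/
theorem coatesWiles_mul (k : ℕ) (g g' : (PowerSeries (LTCoeff F))ˣ) :
    coatesWiles hπ k (g * g') = coatesWiles hπ k g + coatesWiles hπ k g' := by
  rw [coatesWiles, coatesWiles, coatesWiles, logDeriv_mul, map_add, map_add]

/-- `φ(1) = 0`. [cite: deShalit1987, Ch. I §3.5 (i)] -/
theorem coatesWiles_one (k : ℕ) : coatesWiles hπ k (1 : (PowerSeries (LTCoeff F))ˣ) = 0 := by
  rw [coatesWiles, logDeriv_one, map_zero, map_zero]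

/-- ★ **(ii) `φ_{k+1}(g ∘ [a]_f) = a^{k+1} · φ_{k+1}(g)`** for `a ∈ 𝒪[F]`.
[cite: deShalit1987, Ch. I §3.5 (ii)] -/
theorem coatesWiles_eq_of_eq_subst_hom (k : ℕ) (a : 𝒪[F]) (g H : (PowerSeries (LTCoeff F))ˣ)
    (hH : (H : PowerSeries (LTCoeff F)) = (g : PowerSeries (LTCoeff F)).subst
      (hom (isLTRing_LTCoeff hπ) (isLTSeries_LTCoeff π) (isLTSeries_LTCoeff π) (LTCoeff.of F a))) :
    coatesWiles hπ k H = LTCoeff.of F a ^ (k + 1) * coatesWiles hπ k g := by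
  rw [coatesWiles, coatesWiles, logDeriv_eq_of_eq_subst_hom hπ a g H hH, invDeriv_pow_C_mul,
    invDeriv_pow_subst_hom, ← mul_assoc, ← map_mul, ← pow_succ', map_mul, PowerSeries.constantCoeff_C,
    constantCoeff_subst_of_constantCoeff_eq_zero (constantCoeff_hom _ _ _ _)]

/-! ### On the norm-coherent units `𝒰` -/

namespace NormCoherentUnits

variable {hπ}

/-- The Coates–Wiles homomorphisms on `𝒰`: `φ_{k+1}(β) = (D^k δ g_β)(0)`. [cite: deShalit1987, Ch. I §3.5 (11)] -/
def coatesWiles (k : ℕ) (β : NormCoherentUnits hπ) : LTCoeff F :=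
  GaloisRepresentations.coatesWiles hπ k (colemanUnit β)

/-- Unfolding. [cite: deShalit1987, Ch. I §3.5 (11)] -/
theorem coatesWiles_def (k : ℕ) (β : NormCoherentUnits hπ) :
    β.coatesWiles k = GaloisRepresentations.coatesWiles hπ k (colemanUnit β) := rfl

/-- ★ **(i) on `𝒰`: `φ(ββ') = φ(β) + φ(β')`.** [cite: deShalit1987, Ch. I §3.5 (i)] -/
theorem coatesWiles_mul (k : ℕ) (β β' : NormCoherentUnits hπ) :
    (β.mul β').coatesWiles k = β.coatesWiles k + β'.coatesWiles k := by
  rw [coatesWiles_def, colemanUnit_mul, GaloisRepresentations.coatesWiles_mul, coatesWiles_def, coatesWiles_def]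

/-- ★ **(ii) on `𝒰`: `φ_{k+1}(σ_v β) = v^{k+1} φ_{k+1}(β)`** for `v ∈ 𝒪[F]ˣ`. [cite: deShalit1987, Ch. I §3.5 (ii)] -/
theorem coatesWiles_unitAct (k : ℕ) (v : 𝒪[F]ˣ) (β : NormCoherentUnits hπ) :
    (β.unitAct v).coatesWiles k = LTCoeff.of F (v : 𝒪[F]) ^ (k + 1) * β.coatesWiles k :=
  GaloisRepresentations.coatesWiles_eq_of_eq_subst_hom hπ k (v : 𝒪[F]) (colemanUnit β)
    (colemanUnit (β.unitAct v)) (by rw [coe_colemanUnit, coe_colemanUnit, colemanSeries_unitAct])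

/-- ★ **(ii) on `𝒰`: `φ_{k+1}(σβ) = χ_π(σ)^{k+1} φ_{k+1}(β)`** for `σ ∈ Γ_F` (`χ_π` the Lubin–Tate character).
[cite: deShalit1987, Ch. I §3.5 (ii)] -/
theorem coatesWiles_galAct (k : ℕ) (σ : Field.absoluteGaloisGroup F) (β : NormCoherentUnits hπ) :
    (β.galAct σ).coatesWiles k = LTCoeff.of F (lubinTateChar hπ σ : 𝒪[F]) ^ (k + 1) * β.coatesWiles k := by
  rw [galAct_eq_unitAct]; exact coatesWiles_unitAct k _ β

end NormCoherentUnits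

end LocalFieldCW

end Literature.NumberTheory.GaloisRepresentations
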